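import Literature.RepresentationTheory.BorelWallach2000.U11InfinitesimalCharacter
import Literature.NumberTheory.Automorphic.GKModulesPrimaryExact
import HarnessLib

/-!
# Knapp–Vogan Prop. 7.20 at `U(1,1)` in Knapp–Vogan's own indexing: `M = ⨁_θ P_θ(M)` over the characters `θ : Z(𝔤) → ℂ`, as
# `(𝔤, K)`-submodules over the operator ring; `𝒫_θ` exact; composition factors of `P_θ(M)` have infinitesimal character `θ`

Family `hodge`, lane `lit-hodgefound` (foundations library; seat `lit-hodgefound-p39`, generation 22, row g22-#8); topic
`RepresentationTheory/BorelWallach2000`; namespace `…BorelWallach2000.U11Primary` (continued).  Consolidation of the generation: the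
general-`G` files `GKModulesPrimary` / `GKModulesPrimaryExact` (Prop. 7.20, «`𝒫_χ` is exact» for `Z(𝔤) = centerU G`) specialised to
`(𝔤, K)`-modules of `U(1,1)` over the operator ring `GKRing G11`, where — `K = U(1) × U(1)` being connected — Knapp–Vogan's
`P_θ(M)` are `(𝔤, K)`-SUBMODULES (`U11InfinitesimalCharacter`: `U11Weights.isGKSubmodule_primaryComponent`) and irreducibles have
infinitesimal characters (`U11Irred.exists_hasInfinitesimalCharacter`).  ONE `def` with body (`primaryGK hM θ`, via `GKRing.ofGK`),
theorems otherwise; 0 `sorry`, 0 new axioms, no named fact (net debt 0, D-0026).  Compare `U11PrimaryDecomposition` /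
`U11PrimaryComponentsExact`, which index by the pair `(μ, λ)` of generalized eigenvalues of `(ρ𝔤(Z), C)`; here
`P_θ(M) ⊆ P_{(θ(Z), θ(c))}(M)` (`primaryGK_le_primary`).

## The source, verbatim

A. W. Knapp, D. A. Vogan, *Cohomological Induction and Unitary Representations* (1995) [KnappVogan1995], §VII.2 **Proposition
7.20** («`V` is the direct sum of its primary components and only finitely many of them are nonzero … (7.21)»), REMARKS («with `K`
disconnected … the individual primary components need not be `(𝔤, K)` modules» — `K` is connected here), (7.25), (7.26a/b), the
sentence after (7.25) («if `V` has infinitesimal character `λ`, then `V` has generalized infinitesimal character `λ`»); §VII.8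
«Proposition 7.20 implies that `𝒫_χ` is exact»; §VII.13 Cor. 7.207 (proof: «We may assume that `V` has a generalized infinitesimal
character»); §IV.8 Cor. 4.114.

## What is formalised (`M` a `GKRing G11`-module with `hM : IsGKModule`)

* §1 **`primaryGK hM θ : Submodule (GKRing G11) M`** (`restrictScalars_primaryGK` = Knapp–Vogan's `primaryComponent`, `mem_primaryGK_iff`),
  `iSupIndep_primaryGK` ((7.25)), **`iSup_primaryGK_eq_top` / `isInternal_primaryGK`** (Prop. 7.20 for `Z(𝔤)` finite `M`),
  `finite_setOf_primaryGK_ne_bot`, `primaryGK_le_primary`, `hasGenInfinitesimalCharacter_primaryGK` ((7.26b)), **`map_primaryGK_eq`**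
  («`𝒫_χ` is exact» for `(𝔤, K)`-maps), `map_subtype_primaryGK_submodule` (`P_θ(W) = W ∩ P_θ(M)`),
  **`exists_hasGenInfinitesimalCharacter_of_indecomposable`**.
* §2 **`hasInfinitesimalCharacter_of_isIrreducibleGK_of_hasGenInfinitesimalCharacter`** (irreducible + generalized infinitesimal
  character `θ` ⟹ infinitesimal character `θ`) and **`hasInfinitesimalCharacter_factor_primaryGK`** (every composition factor
  `↥Y ⧸ X`, `X ⋖ Y`, of `P_θ(M)` has infinitesimal character `θ`).

Consumed by name: `primaryComponent`, `mem_primaryComponent_iff`, `iSupIndep_primaryComponent`, `iSup_primaryComponent_eq_top`,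
`finite_setOf_primaryComponent_ne_bot`, `exists_forall_pow_centerAction_apply_eq_zero`, `hasGenInfinitesimalCharacter_iff_primaryComponent_eq_top`
(`GKModulesPrimary`); `map_pow_centerAction_sub_apply`, `GKRing.restrictScalars_comp_actLie`, `GKRing.map_primaryComponent_eq`,
`GKRing.mem_primaryComponent_submodule_iff`, `GKRing.hasGenInfinitesimalCharacter_submodule_quotient` (`GKModulesPrimaryExact`);
`U11Weights.isGKSubmodule_primaryComponent`, `U11Irred.exists_hasInfinitesimalCharacter`, `HasInfinitesimalCharacter.unique`
(`U11InfinitesimalCharacter`); `primaryComponent_le_primary`, `u11ZCenter`, `upqCasimirCenter` (`UpqCasimirCenter`); `U11Primary.primary`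
(`U11PrimaryDecomposition`); `GKRing.ofGK`, `Factor`, `isGKModule_submodule/_factor`, `isIrreducibleGK_factor` (`GKModuleRing`, `GKJordanHolder`).

## References

* A. W. Knapp, D. A. Vogan, *Cohomological Induction and Unitary Representations*, Princeton Math. Ser. 45 (1995), §IV.8 Cor. 4.114,
  §VII.2 Prop. 7.20, (7.21), (7.25), (7.26a/b), §VII.8 (7.141), Cor. 7.132, §VII.13 Cor. 7.207 (proof). [KnappVogan1995]
-/


noncomputable section

open scoped Matrix ComplexConjugate
open Polynomial Module Module.End UniversalEnvelopingAlgebra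

namespace Literature.RepresentationTheory.BorelWallach2000

open Literature.Algebra.Lie Literature.Algebra.Lie.ChevalleyEilenberg
open Literature.NumberTheory.Automorphic
open Literature.RepresentationTheory.KonnoKonno2007 Literature.RepresentationTheory.KonnoKonno2007.RealDualPair
open Literature.RepresentationTheory.KonnoKonno2007.RealDualPair.UForm
open Literature.LinearAlgebra
open U11HolDS

-- Mathlib idiom (as in `GKModules`, `GKCohomology`): commutator bracket on `Module.End` / matrices
attribute [local instance 100] LieRing.ofAssociativeRing

-- carriers `↥W`, `M ⧸ W`, `Factor` over `GKRing G11` with their `ℂ`-structures (as in `GKModuleRing` §7–§8)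
set_option maxSynthPendingDepth 4

namespace U11Primary

open U11Irred U11HC

variable {M : Type*} [AddCommGroup M] [Module ℂ M] [Module (GKRing G11) M] [IsScalarTower ℂ (GKRing G11) M]
variable (hM : IsGKModule G11 (GKRing.actK G11 M) (GKRing.actLie G11 M))

/-! ## §1 `P_θ(M)` as a `(𝔤, K)`-submodule over the operator ring -/

/-- **Knapp–Vogan's primary component `P_θ(M)` of a `(𝔤, K)`-module of `U(1,1)` as a `GKRing G11`-submodule** (it is `K`-stable
because `K = U(1) × U(1)` is connected: `U11Weights.isGKSubmodule_primaryComponent`). [cite: KnappVogan1995, §VII.2 Prop. 7.20 (Remarks)] -/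
def primaryGK (θ : centerU G11 →ₐ[ℝ] ℂ) : Submodule (GKRing G11) M :=
  GKRing.ofGK (primaryComponent (GKRing.actLie G11 M) θ) (U11Weights.isGKSubmodule_primaryComponent hM θ)

/-- As a complex subspace `P_θ(M)` is Knapp–Vogan's primary component. [cite: KnappVogan1995, §VII.2 (before Prop. 7.20)] -/
theorem restrictScalars_primaryGK (θ : centerU G11 →ₐ[ℝ] ℂ) :
    (primaryGK hM θ).restrictScalars ℂ = primaryComponent (GKRing.actLie G11 M) θ := rfl

/-- Membership. [cite: KnappVogan1995, §VII.2 (before Prop. 7.20)] -/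
theorem mem_primaryGK_iff {θ : centerU G11 →ₐ[ℝ] ℂ} {m : M} :
    m ∈ primaryGK hM θ ↔ ∀ z : centerU G11, ∃ n : ℕ, ((centerAction (GKRing.actLie G11 M) z - θ z • 1) ^ n) m = 0 :=
  mem_primaryComponent_iff (GKRing.actLie G11 M)

/-- **(7.25) over the operator ring: the `P_θ(M)` are independent.** [cite: KnappVogan1995, §VII.2 Prop. 7.20 (7.25)] -/
theorem iSupIndep_primaryGK : iSupIndep fun θ : centerU G11 →ₐ[ℝ] ℂ => primaryGK hM θ := by
  have h1 := iSupIndep_primaryComponent (GKRing.actLie G11 M)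
  rw [iSupIndep_def] at h1 ⊢
  intro θ
  have h2 := h1 θ
  rw [disjoint_iff] at h2 ⊢
  apply Submodule.restrictScalars_injective ℂ
  rw [Submodule.restrictScalars_inf, Submodule.restrictScalars_bot, restrictScalars_primaryGK]
  simp only [Submodule.restrictScalars_iSup, restrictScalars_primaryGK]
  exact h2

/-- **Prop. 7.20 at `U(1,1)`, Knapp–Vogan's indexing: a `Z(𝔤)` finite `(𝔤, K)`-module is the sum of its `P_θ(M)`.**
[cite: KnappVogan1995, §VII.2 Prop. 7.20] -/
theorem iSup_primaryGK_eq_top (hfin : IsCenterFinite (GKRing.actLie G11 M)) :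
    ⨆ θ : centerU G11 →ₐ[ℝ] ℂ, primaryGK hM θ = ⊤ := by
  have h1 := iSup_primaryComponent_eq_top (GKRing.actLie G11 M) hfin
  apply Submodule.restrictScalars_injective ℂ
  rw [Submodule.restrictScalars_iSup, Submodule.restrictScalars_top]
  simp only [restrictScalars_primaryGK]
  exact h1

/-- **Prop. 7.20 at `U(1,1)`: `M = ⨁_θ P_θ(M)`, an internal direct sum of `(𝔤, K)`-submodules over the operator ring, for every
`Z(𝔤)` finite `M`.** [cite: KnappVogan1995, §VII.2 Prop. 7.20] -/
theorem isInternal_primaryGK [DecidableEq (centerU G11 →ₐ[ℝ] ℂ)] (hfin : IsCenterFinite (GKRing.actLie G11 M)) :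
    DirectSum.IsInternal fun θ : centerU G11 →ₐ[ℝ] ℂ => primaryGK hM θ :=
  (DirectSum.isInternal_submodule_iff_iSupIndep_and_iSup_eq_top _).mpr ⟨iSupIndep_primaryGK hM, iSup_primaryGK_eq_top hM hfin⟩

/-- «only finitely many of them are nonzero». [cite: KnappVogan1995, §VII.2 Prop. 7.20] -/
theorem finite_setOf_primaryGK_ne_bot (hfin : IsCenterFinite (GKRing.actLie G11 M)) :
    {θ : centerU G11 →ₐ[ℝ] ℂ | primaryGK hM θ ≠ ⊥}.Finite := by
  refine (finite_setOf_primaryComponent_ne_bot (GKRing.actLie G11 M) hfin).subset fun θ hθ h0 => hθ ?_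
  apply Submodule.restrictScalars_injective ℂ
  rw [restrictScalars_primaryGK, h0, Submodule.restrictScalars_bot]

/-- **`P_θ(M) ⊆ P_{(θ(Z), θ(c))}(M)`**: Knapp–Vogan's decomposition refines the lineage's `(Z, C)`-decomposition
(`U11PrimaryDecomposition`). [cite: KnappVogan1995, §VII.2 Prop. 7.20] -/
theorem primaryGK_le_primary (θ : centerU G11 →ₐ[ℝ] ℂ) :
    primaryGK hM θ ≤ primary hM (θ u11ZCenter) (θ (upqCasimirCenter (Fin 1) (Fin 1))) := fun _ hm =>
  primaryComponent_le_primary hM θ hm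

/-- `P_θ(M)` has generalized infinitesimal character `θ` (for `Z(𝔤)` finite `M`). [cite: KnappVogan1995, §VII.2 (7.26a)–(7.26b)] -/
theorem hasGenInfinitesimalCharacter_primaryGK (hfin : IsCenterFinite (GKRing.actLie G11 M)) (θ : centerU G11 →ₐ[ℝ] ℂ) :
    HasGenInfinitesimalCharacter (GKRing.actLie G11 (primaryGK hM θ)) θ := by
  obtain ⟨N, hN⟩ := exists_forall_pow_centerAction_apply_eq_zero (GKRing.actLie G11 M) hfin
  refine ⟨⟨N, fun z w => Subtype.ext ?_⟩⟩
  rw [Submodule.coe_zero, ← (primaryGK hM θ).subtype_apply, ← LinearMap.restrictScalars_apply ℂ (primaryGK hM θ).subtype,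
    map_pow_centerAction_sub_apply _ (GKRing.actLie G11 M) ((primaryGK hM θ).subtype.restrictScalars ℂ)
      (GKRing.restrictScalars_comp_actLie (primaryGK hM θ).subtype), LinearMap.restrictScalars_apply, Submodule.subtype_apply]
  exact hN θ w w.2 z

variable {M' : Type*} [AddCommGroup M'] [Module ℂ M'] [Module (GKRing G11) M'] [IsScalarTower ℂ (GKRing G11) M']
variable (hM' : IsGKModule G11 (GKRing.actK G11 M') (GKRing.actLie G11 M'))

/-- **«`𝒫_χ` is exact» over the operator ring at `U(1,1)`, Knapp–Vogan's indexing**: `f(P_θ(M)) = f(M) ∩ P_θ(M′)` for a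
`(𝔤, K)`-map `f` out of a `Z(𝔤)` finite `M`. [cite: KnappVogan1995, §VII.8 (before (7.141))] -/
theorem map_primaryGK_eq (hfin : IsCenterFinite (GKRing.actLie G11 M)) (f : M →ₗ[GKRing G11] M') (θ : centerU G11 →ₐ[ℝ] ℂ) :
    (primaryGK hM θ).map f = LinearMap.range f ⊓ primaryGK hM' θ := by
  apply Submodule.restrictScalars_injective ℂ
  rw [Submodule.restrictScalars_map, restrictScalars_primaryGK, Submodule.restrictScalars_inf, restrictScalars_primaryGK,
    GKRing.map_primaryComponent_eq hfin f θ, LinearMap.range_restrictScalars]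

/-- **`P_θ(W) = W ∩ P_θ(M)` for a `(𝔤, K)`-submodule `W`** (no finiteness). [cite: KnappVogan1995, §VII.8 Cor. 7.132 (proof)] -/
theorem map_subtype_primaryGK_submodule (W : Submodule (GKRing G11) M) (θ : centerU G11 →ₐ[ℝ] ℂ) :
    (primaryGK (GKRing.isGKModule_submodule G11 M W hM) θ).map W.subtype = W ⊓ primaryGK hM θ := by
  ext m
  constructor
  · rintro ⟨w, hw, rfl⟩
    exact ⟨w.2, (GKRing.mem_primaryComponent_submodule_iff W θ w).mp hw⟩
  · rintro ⟨hmW, hm⟩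
    exact ⟨⟨m, hmW⟩, (GKRing.mem_primaryComponent_submodule_iff W θ ⟨m, hmW⟩).mpr hm, rfl⟩

include hM in
/-- **An indecomposable non-zero `Z(𝔤) finite `(𝔤, K)`-module of `U(1,1)` has a generalized infinitesimal character** (Prop. 7.20
splits it into the `(𝔤, K)`-submodules `P_θ(M) ⊕ ⨁_{θ' ≠ θ} P_{θ'}(M)`). [cite: KnappVogan1995, §VII.2 Prop. 7.20] -/
theorem exists_hasGenInfinitesimalCharacter_of_indecomposable [Nontrivial M] (hfin : IsCenterFinite (GKRing.actLie G11 M))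
    (hind : ∀ A B : Submodule (GKRing G11) M, IsCompl A B → A = ⊥ ∨ B = ⊥) :
    ∃ θ : centerU G11 →ₐ[ℝ] ℂ, HasGenInfinitesimalCharacter (GKRing.actLie G11 M) θ := by
  have hex : ∃ θ : centerU G11 →ₐ[ℝ] ℂ, primaryGK hM θ ≠ ⊥ := by
    by_contra hall
    push Not at hall
    have htop := iSup_primaryGK_eq_top hM hfin
    rw [iSup_eq_bot.mpr hall] at htop
    exact bot_ne_top htop
  obtain ⟨θ, hθ⟩ := hex
  refine ⟨θ, (hasGenInfinitesimalCharacter_iff_primaryComponent_eq_top _ hfin θ).mpr ?_⟩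
  have hcompl : IsCompl (primaryGK hM θ) (⨆ (θ' : centerU G11 →ₐ[ℝ] ℂ) (_ : θ' ≠ θ), primaryGK hM θ') :=
    ⟨(iSupIndep_def.mp (iSupIndep_primaryGK hM)) θ, by
      rw [codisjoint_iff, ← iSup_primaryGK_eq_top hM hfin]
      exact (iSup_split_single (fun θ' => primaryGK hM θ') θ).symm⟩
  rcases hind _ _ hcompl with h0 | h0
  · exact absurd h0 hθ
  · have h1 := hcompl.sup_eq_top
    rw [h0, sup_bot_eq] at h1
    rw [← restrictScalars_primaryGK hM, h1, Submodule.restrictScalars_top]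

/-! ## §2 Infinitesimal characters of composition factors -/

/-- **An irreducible `(𝔤, K)`-module of `U(1,1)` with generalized infinitesimal character `θ` has infinitesimal character `θ`**
(it has one, `U11Irred.exists_hasInfinitesimalCharacter`, which is then a generalized one, and those are unique).
[cite: KnappVogan1995, §IV.8 Cor. 4.114, §VII.2 (7.26a)] -/
theorem hasInfinitesimalCharacter_of_isIrreducibleGK_of_hasGenInfinitesimalCharacter {V : Type*} [AddCommGroup V] [Module ℂ V]
    {σK : Representation ℂ G11.maximalCompact V} {σ𝔤 : G11.lie →ₗ⁅ℝ⁆ Module.End ℂ V} (hV : IsGKModule G11 σK σ𝔤)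
    (hirr : IsIrreducibleGK σK σ𝔤) {θ : centerU G11 →ₐ[ℝ] ℂ} (h : HasGenInfinitesimalCharacter σ𝔤 θ) :
    HasInfinitesimalCharacter σ𝔤 θ := by
  haveI := hirr.nontrivial
  obtain ⟨θ', hθ'⟩ := U11Irred.exists_hasInfinitesimalCharacter hV hirr
  rwa [← hθ'.hasGenInfinitesimalCharacter.unique σ𝔤 h]

include hM in
/-- **Every composition factor of `P_θ(M)` has infinitesimal character `θ`** (`Z(𝔤)` finite `M`): on the irreducible consecutive
quotient `↥Y ⧸ X` of a step `X ⋖ Y` inside `P_θ(M)` every `z ∈ Z(𝔤)` acts by `θ(z)`. [cite: KnappVogan1995, §VII.2 (after (7.25)), §VII.13 Cor. 7.207 (proof)] -/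
theorem hasInfinitesimalCharacter_factor_primaryGK (hfin : IsCenterFinite (GKRing.actLie G11 M)) (θ : centerU G11 →ₐ[ℝ] ℂ)
    {X Y : Submodule (GKRing G11) (primaryGK hM θ)} (hXY : X ⋖ Y) :
    HasInfinitesimalCharacter (GKRing.actLie G11 (GKRing.Factor (X, Y))) θ := by
  have h1 := (GKRing.hasGenInfinitesimalCharacter_submodule_quotient (hasGenInfinitesimalCharacter_primaryGK hM hfin θ) Y).1
  have h2 := (GKRing.hasGenInfinitesimalCharacter_submodule_quotient h1 (X.comap Y.subtype)).2
  exact hasInfinitesimalCharacter_of_isIrreducibleGK_of_hasGenInfinitesimalCharacter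
    (GKRing.isGKModule_factor G11 _ (X, Y) (GKRing.isGKModule_submodule G11 M _ hM)) (GKRing.isIrreducibleGK_factor hXY) h2

end U11Primary

end Literature.RepresentationTheory.BorelWallach2000
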